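import Summits.CriticalPhenomena.Ising3DConformalLimit.Theses.UnitLightCone
import Summits.CriticalPhenomena.Ising3DConformalLimit.Theorems.GaussianScaleMixtureRotationUpgradeFromTwoPoint
import HarnessLib

/-!
# Crux `UnitLightCone.TwoPointIsotropyToAllN` (item stmt-CriticalPhenomena-17168) — PROVED

Route `route-CriticalPhenomena-UnitLightCone`, crux (N), rank 3:
`Summit.CriticalPhenomena.Ising3DConformalLimit.Theses.UnitLightCone.TwoPointIsotropyToAllN` — for every normalised,
non-degenerate, translation-invariant, scale-covariant pointwise scaling limit `S` of `criticalCorr 3`,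
`O(3)`-invariance of the two-point kernel `S 2 (0, R x) = S 2 (0, x)` implies `IsRotationInvariant S` (all `n`).

## Proof (line `Sketch` = `Lines/birth.lean`, 0 stubs)

The crux is, up to DROPPING the vacuous guard `x ≠ 0` in its two-point-isotropy hypothesis, verbatim the sibling crux
`Summit.CriticalPhenomena.Ising3DConformalLimit.Theses.GaussianScaleMixture.RotationUpgradeFromTwoPoint`
(item stmt-CriticalPhenomena-8367), closed · proved by the landed, sorry-free theorem
`Summit.CriticalPhenomena.Ising3DConformalLimit.Cruxes.RotationUpgradeFromTwoPoint.NullLaplacianEdgeGaussianity.rotationUpgradeFromTwoPoint_proof`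
(`Theorems/GaussianScaleMixtureRotationUpgradeFromTwoPoint.lean`).  Since the sibling assumes two-point isotropy only
off the origin it is formally the STRONGER statement; conversely a linear isometry fixes `0`, so the guard is vacuous
and the two cruxes are equivalent propositions (both implications are recorded below).

Contents:
* `TwoPointIsotropyToAllN_of_rotationUpgrade` — the reduction sibling ⇒ crux (drop the guard);
* `rotationUpgrade_of_twoPointIsotropyToAllN` — the converse (guard vacuous via `map_zero`);
* `TwoPointIsotropyToAllN_of` / `twoPointIsotropyToAllN_proof` — the crux BY NAME, hypothesis-free.
-/

namespace Summit.CriticalPhenomena.Ising3DConformalLimit.Theorems.UnitLightConeTwoPointIsotropyToAllN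

/-- Reduction (the whole line): the landed sibling crux `GaussianScaleMixture.RotationUpgradeFromTwoPoint` (two-point
isotropy assumed only off the origin) implies `UnitLightCone.TwoPointIsotropyToAllN` (two-point isotropy assumed
everywhere) — drop the guard `x ≠ 0`. -/
theorem TwoPointIsotropyToAllN_of_rotationUpgrade
    (h : _root_.Summit.CriticalPhenomena.Ising3DConformalLimit.Theses.GaussianScaleMixture.RotationUpgradeFromTwoPoint) :
    _root_.Summit.CriticalPhenomena.Ising3DConformalLimit.Theses.UnitLightCone.TwoPointIsotropyToAllN := by
  intro ρ Δ S hρ hlim hnorm hnd htr hsc hiso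
  exact h ρ Δ S hρ hlim hnorm hnd htr hsc (fun R x _ => hiso R x)

/-- Converse reduction: `UnitLightCone.TwoPointIsotropyToAllN` implies the sibling crux
`GaussianScaleMixture.RotationUpgradeFromTwoPoint` — the guard `x ≠ 0` is vacuous because a linear isometry
fixes the origin (`map_zero`). -/
theorem rotationUpgrade_of_twoPointIsotropyToAllN
    (h : _root_.Summit.CriticalPhenomena.Ising3DConformalLimit.Theses.UnitLightCone.TwoPointIsotropyToAllN) :
    _root_.Summit.CriticalPhenomena.Ising3DConformalLimit.Theses.GaussianScaleMixture.RotationUpgradeFromTwoPoint := by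
  intro ρ Δ S hρ hlim hnorm hnd htr hsc hiso
  refine h ρ Δ S hρ hlim hnorm hnd htr hsc ?_
  intro R x
  by_cases hx : x = 0
  · subst hx
    rw [map_zero]
  · exact hiso R x hx

/-- **`TwoPointIsotropyToAllN_of` — the crux BY NAME, sorry-free** (the registered composition of the 0-stub line),
from the landed theorem `rotationUpgradeFromTwoPoint_proof` (item stmt-CriticalPhenomena-8367, proved). -/
theorem TwoPointIsotropyToAllN_of :
    _root_.Summit.CriticalPhenomena.Ising3DConformalLimit.Theses.UnitLightCone.TwoPointIsotropyToAllN :=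
  TwoPointIsotropyToAllN_of_rotationUpgrade
    _root_.Summit.CriticalPhenomena.Ising3DConformalLimit.Cruxes.RotationUpgradeFromTwoPoint.NullLaplacianEdgeGaussianity.rotationUpgradeFromTwoPoint_proof

/-- **Crux `UnitLightCone.TwoPointIsotropyToAllN` (item stmt-CriticalPhenomena-17168) — PROVED.**  For every
normalised, non-degenerate, translation-invariant, scale-covariant pointwise scaling limit `S` of the critical `ℤ³`
Ising correlators, `O(3)`-invariance of the two-point kernel upgrades to `IsRotationInvariant S` at all orders.
(Closing theorem; the item is released `--by` this name.) -/
theorem twoPointIsotropyToAllN_proof :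
    _root_.Summit.CriticalPhenomena.Ising3DConformalLimit.Theses.UnitLightCone.TwoPointIsotropyToAllN :=
  TwoPointIsotropyToAllN_of

end Summit.CriticalPhenomena.Ising3DConformalLimit.Theorems.UnitLightConeTwoPointIsotropyToAllN
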